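import Literature.NumberTheory.EllipticCurves.Rank1Residual.Typed.PAdicCertificateEngine
import Literature.NumberTheory.EllipticCurves.IwasawaLeadingTermOddPrime
import Literature.NumberTheory.EllipticCurves.BSDSelmerPConverseSerreProofs
import Literature.NumberTheory.EllipticCurves.Rank1Residual.X10Proofs
import HarnessLib

/-!
# Kato's integral divisibility ∘ engine at an odd GOOD ORDINARY prime with `ρ_{E,p^∞}` surjective — the class X10a′ instance at `p = 3` (cell `b2b-bsdres`)

HONEST FRAMING (run/shared/lean/b2b/bsd-rank1-residual/, verbatim): the goal of the cell is to
DELETE the COMBINATION-SHAPED residual classes for ALL analytic-rank `≤ 1` elliptic curves over `ℚ`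
— "full BSD formula for every rank `≤ 1` curve in class C" assembled STRICTLY from published
theorems — so that the rank-`≤ 1` remainder becomes exactly the CONSTRUCTION-SHAPED classes, which
are TYPED (missing-input `Prop`s), NOT attempted. This is not "finishing BSD".

Theorems only (no definition, no new named fact). Fourth companion of the fact-agnostic engine
`Typed/PAdicCertificateEngine.lean` (p179575), after `Typed/PAdicCertificateReducible.lean`
(Wuthrich 2014 Thm. 16, reducible good ordinary `p ≥ 5`), `Typed/PAdicCertificateSemistable.lean`
/ `…Multiplicative…` / `…Surjective…` / `…SurjectiveThree.lean` (multiplicative `p`). HERE: a GOOD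
ORDINARY odd prime `p` at which the `p`-ADIC representation is surjective
(`∀ n, ρ̄_{E,p^n}` onto `GL₂(ℤ/p^n)`). Both class-level inputs of the engine are then NAMED FACTS OF
THE TREE, both PUBLISHED and both printed for every odd `p`:

* the divisibility is clause (3) of `kato_divisibility` (K. Kato, Astérisque 295 (2004), Thm. 17.4
  (3), p. 273, with Thm. 12.5 (4): "Assume `p ≠ 2`" and the image of `Gal(ℚ̄/ℚ) → GL_{ℤ_p}(T_pE)`
  contains `SL₂(ℤ_p)` — implied by the surjectivity hypothesis): `X(E/ℚ_∞)` is `Λ`-torsion and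
  `L_p(f, α) = ι g` with `g ∈ char_Λ X` — INTEGRALLY, no period and no power of `p`;
* the leading-term shape is Perrin-Riou–Schneider as printed by Balakrishnan–Müller–Stein, Math.
  Comp. 85 (2016), Thm. 1.7 for `p > 2` (`Schneider1985_order_charGenerator_odd`, x1b gen 4,
  p181616: `T^r ∣ f_E`; `ord f_E = r ↔ (Reg_p ≠ 0 ∧ Ш[p^∞] finite)`;
  `[T^r]f_E · log_p(γ)^r · #E(ℚ)_tors² = u · (1 - α⁻¹)² · #Ш[p^∞] · Reg_p · ∏ c_ℓ` for THE canonical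
  cyclotomic height, which exists uniquely at every odd good ordinary `p`, `PadicSigmaOddPrime.lean`).

So the engine's hypotheses `hι` (`c = 1`, `e = 0`), `hXk`, `hLT` are DISCHARGED and what is left is
exactly the per-curve computed data: `ord_{T=0} L_p(f, α) = r` (`hord`) and ONE valuation equality
(`hcert`). This is the argument of W. Stein and C. Wuthrich, *Algorithms for the arithmetic of
elliptic curves using Iwasawa theory*, Math. Comp. 82 (2013) §§3–4, 8 (printed under "`ρ̄`
surjective", with the `p`-adic surjectivity supplied by Serre at `p ≥ 5`), as a kernel theorem from
the tree's facts — at EVERY odd `p`, in particular at `p = 3`, where `p`-adic surjectivity is NOT a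
consequence of mod-`3` surjectivity in general (Elkies) but IS at a prime `3` of good (or
multiplicative) reduction: Wuthrich, Doc. Math. 19 (2014) Lemma 20 (tree fact
`Wuthrich2014.lemma20_surjective_threeAdic_of_semistable`, p177650).

**Why (class X10a′ ∧ r = 1 at `p = 3`; HOME/X10-AUDIT.md §10).** X10a′ = `p = 3` good ordinary,
`E[3]` irreducible, off the printed floor, WITH `surj(3)`; on the census every rank-one X10a′ pair
(`N < 2·10⁴`: 117) has `surj(3)`. Its CLASS-level closure is Yan–Zhu 2026 Thm. 4.15 with the literal
flag `YZ26@3-BF-ERL-Ohta` (the Beilinson–Flach reciprocity laws in Hida families are printed for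
`p ≥ 5` only; referee R9.1/R10.1). Per curve, two flag-free routes are on file: lever L11 (Jetchev /
Kolyvagin over a Heegner field minus Skinner's `3`-part of the twist; reaches only pairs with `≤ 1`
Tamagawa number divisible by `3`, 69/117) and an explicit `3`-descent `Ш(E)[3] = 0` (117/117, ONE
engine; upper bound unconditional at 80, GRH-conditional at 37 — referee R31.4: "single-engine
certificates"). THIS file is the
kernel side of a THIRD route, disjoint from both in its published inputs (Kato's Euler system +
Perrin-Riou–Schneider, no Heegner point beyond GZK, no Beilinson–Flach element, no descent) and in
its computation (`3`-adic `L`-function and `3`-adic regulator): insensitive to Tamagawa numbers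
divisible by `3` (they sit on both sides of `hcert`), so it reaches the 48 tier-β pairs that L11
cannot. The numbers (two `L`-side engines, PARI `ellpadicL`/`ellpadicbsd` and the literature seat's
PARI-free modular-symbol engine; two regulator engines, PARI `ellpadicregulator` and the cell's
PARI-free, `E₂`-free σ-function engine `sigmaheight.py` — the canonical Mazur–Tate height pinned by
the INTEGRALITY characterisation of Mazur–Tate 1991 / Mazur–Stein–Tate 2006 Thm. 1.3 and Alg. 3.3,
whose self-test reproduces the printed 37a1 example of MST 2006 §4.1 digit for digit) are in
HOME/b2b-bsdres-x10/g4/ (X10-AUDIT.md §10). Per curve; NOT a class theorem; no label or verdict is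
changed by this file; the lane books.

**On the period.** Kato's clause (3) is transcribed in the tree with `f`'s own period
(`padicLFunction f α` is built on `[r]⁺_f = re{∞,r}_f/Ω⁺_f`), so the certificate `hcert` below is
stated for `[T^r] L_p(f, α)` with NO period scalar. Engines compute `E`-normalised symbols
`[r]⁺_E = ϖ · [r]⁺_f`, `ϖ · Ω_E = Ω⁺_f`; the variant `…_of_periodUnit` takes the computed
`ϖ · [T^r]L_p` together with `ord_p ϖ = 0` (at an odd good `p` with `E[p]` irreducible `ϖ` is a
`p`-adic unit: no `p`-isogeny in the class, and `p ∤ c_E` for the Manin constant at `p ∤ 2N` —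
Mazur 1978 / Abbes–Ullmo 1996; recorded as a HYPOTHESIS `hϖv`, checked per curve by the engines,
not asserted).

* `padicBSD_inequality_of_kato_of_surjective_pow` — the Stein–Wuthrich inequality
  `ord_p #Ш[p^∞] + ord_p((1-α⁻¹)² Reg_p ∏c_ℓ) ≤ ord_p([T^r]L_p · log_p(γ)^r · #E(ℚ)_tors²)` at an odd
  good ordinary `p` with `ρ_{E,p^∞}` surjective, given `ord_{T=0} L_p = r` (class-wide BOUND).
* `noPTorsion_of_kato_of_leadingTerm_certificate` — `+ hcert ⇒ Ш(E/ℚ)[p] = 0`.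
* `…_of_periodUnit` — the same with the `E`-normalised leading coefficient `ϖ · [T^r]L_p`.
* `bsdp_of_kato_of_leadingTerm_certificate` — analytic rank `≤ 1`, `p ∤ #Ш_an` (GZK) ⇒ `BSD(E,p)`.
* `bsdp_of_kato_of_surj_of_leadingTerm_certificate` — the census hypothesis `Surj W p` (mod `p`)
  at any odd good ordinary `p`: `p ≥ 5` Serre (tree theorem), `p = 3` Wuthrich Lemma 20 (fact).
* `X10.bsdp_three_of_kato_of_leadingTerm_certificate` — the canonical X10 shape:
  `ClassX10 W 3 → Surj W 3 → (named facts) → (3-adic certificate) → 3 ∤ #Ш_an → BSDp W 3`.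

References: [Kato2004Asterisque] Thm. 17.4 (p. 273), Thm. 12.5 (4) (p. 222);
[BalakrishnanMullerStein2015] Thm. 1.7, p. 3; [Schneider1985]; [Balakrishnan2016] §2;
[SteinWuthrich2013] §§3–4, §8; [Wuthrich2014] Lemma 20 (p. 400); [Miller2011LMS] Def. 1.1,
Prop. 7.6; [SerreAbelianLadic1968] IV §3.4; Darmon CBMS 101 Thm. 3.22 (GZK).
-/

set_option autoImplicit false

noncomputable section

open scoped Classical MatrixGroups ModularForm

open CongruenceSubgroup WeierstrassCurve Literature.NumberTheory.EllipticCurves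
  Literature.NumberTheory.EllipticCurves.ModularForms
  Literature.NumberTheory.EllipticCurves.Rank1Residual
  Literature.NumberTheory.EllipticCurves.Wuthrich2014

namespace Literature.NumberTheory.EllipticCurves.Rank1Residual.Typed

/-! ### The Stein–Wuthrich inequality at an odd good ordinary prime with surjective `ρ_{E,p^∞}` -/

/-- **The `p`-adic BSD inequality at an odd good ordinary prime with `ρ_{E,p^∞}` surjective**
(Stein–Wuthrich 2013 §§3–4, assembled from Kato's Thm. 17.4 (3) and Perrin-Riou–Schneider as
printed by Balakrishnan–Müller–Stein 2016 Thm. 1.7, `p > 2`). `W` globally minimal, `p ≠ 2` good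
ordinary (`hgood`, `hordp`), `ρ̄_{E,p^n}` surjective for every `n` (`hsurj`), `f` a newform of `E`
(`hf`), `Dh` THE canonical `p`-adic height datum (`hDh`), `r = rank E(ℚ)`; named facts `hK` (Kato,
`kato_divisibility` for every cyclotomic datum) and `hS` (`Schneider1985_order_charGenerator_odd`);
computed: `ord_{T=0} L_p(f, α) = r` (`hord`). Then `Ш(E/ℚ)[p^∞]` is finite, the canonical height is
non-degenerate, and
`ord_p #Ш[p^∞] + ord_p((1 - α⁻¹)² · ∏ c_ℓ · Reg_p) ≤ ord_p([T^r]L_p · log_p(γ_cyc)^r · #E(ℚ)_tors²)`.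
Instance of `padicValNat_card_shaPrimary_le_of_leadingTerm_shape` with `c = 1`, `e = 0`.
[cite: Kato2004Asterisque, Thm. 17.4 (3) (p. 273)] [cite: BalakrishnanMullerStein2015, Thm. 1.7]
[cite: SteinWuthrich2013, §§3–4] -/
theorem padicBSD_inequality_of_kato_of_surjective_pow
    (hS : Schneider1985_order_charGenerator_odd)
    (W : WeierstrassCurve ℚ) [W.IsElliptic] [W.IsGloballyMinimal] (p : ℕ) [Fact p.Prime]
    {N : ℕ} [NeZero N] (f : CuspForm (Gamma0 N) 2)
    (hK : ∀ (κ : ZpExtension ℚ p) (γ : Field.absoluteGaloisGroup ℚ),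
      kato_divisibility W p (κ := κ) (γ := γ) (f := f))
    (hp : p ≠ 2) (hgood : W.HasGoodReductionAtPrime p) (hordp : ¬ (p : ℤ) ∣ W.frobeniusTrace p)
    (hsurj : ∀ n : ℕ, W.HasSurjectiveModNGaloisRep (p ^ n : ℕ)) (hf : IsNewformOf W f)
    (Dh : PAdicHeightData W p) (hDh : Dh.IsCanonical)
    (hord : (padicLFunction f (unitRoot W p : ℚ_[p])).order = W.mordellWeilRank) :
    Finite (AddCommGroup.primaryComponent W.sha p) ∧ SchneiderConjecture Dh ∧
      (padicValNat p (Nat.card (AddCommGroup.primaryComponent W.sha p)) : ℤ) +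
          ((1 - (unitRoot W p : ℚ_[p])⁻¹) ^ 2 * (W.tamagawaProduct : ℚ_[p]) *
            padicRegulator Dh).valuation ≤
        (PowerSeries.coeff W.mordellWeilRank (padicLFunction f (unitRoot W p : ℚ_[p])) *
          (padicLog p (cyclotomicGenerator p) ^ W.mordellWeilRank *
            (W.torsionOrder : ℚ_[p]) ^ 2)).valuation := by
  have hordin : IsOrdinaryAt W p := ⟨hgood, hordp⟩
  set r := W.mordellWeilRank with hr_def
  set L := padicLFunction f (unitRoot W p : ℚ_[p]) with hL_def
  -- the cyclotomic setting, the Iwasawa module, Kato's Thm. 17.4 (3), a generator of `char_Λ X`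
  obtain ⟨κ, hκ, γ, hγ, hγ'⟩ := exists_isCyclotomic_isTopGenerator_isCyclotomicVariable_holds p
  obtain ⟨D⟩ := W.nonempty_selmerDualData_holds κ γ hγ
  haveI : Module.Finite (IwasawaAlgebra p) D.X := D.module_finite_holds hγ
  obtain ⟨hX, -, h3⟩ := hK κ γ hp hordin hκ hγ hγ' hf D
  obtain ⟨g, hgmem, hιg⟩ := h3 hsurj
  haveI : (Module.charIdeal (IwasawaAlgebra p) D.X).IsPrincipal := charIdeal_isPrincipal_holds p D.X
  obtain ⟨fE, hchar⟩ := Submodule.IsPrincipal.principal (Module.charIdeal (IwasawaAlgebra p) D.X)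
  have hchar' : D.charIdeal = Ideal.span {fE} := hchar
  obtain ⟨h1, h2, hLC⟩ := hS W p hp hgood hordp κ γ hκ hγ hγ' D hX fE hchar' Dh hDh
  -- the engine's inputs (`c = 1`, `e = 0`)
  have hι : PowerSeries.C (1 : ℚ_[p]) * L = PowerSeries.X ^ 0 * iwasawaToPowerSeries p g := by
    rw [map_one, one_mul, pow_zero, one_mul, hιg]
  have hordL : L.order = (r + 0 : ℕ) := by rw [Nat.add_zero]; exact hord
  have hXk : (PowerSeries.X : IwasawaAlgebra p) ^ r ∣ fE :=
    PowerSeries.X_pow_dvd_iff.mpr fun m hm =>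
      PowerSeries.coeff_of_lt_order m (lt_of_lt_of_le (by exact_mod_cast hm) h1)
  -- `A = (1 - α⁻¹)² · ∏ c_ℓ ≠ 0`
  obtain ⟨u₂, hu₂⟩ := exists_unit_one_sub_unitRoot_inv p W hordin
  have hε0 : (1 - (unitRoot W p : ℚ_[p])⁻¹) ^ 2 ≠ 0 := by
    rw [hu₂]
    refine pow_ne_zero 2 (mul_ne_zero (coe_units_ne_zero p u₂) ?_)
    exact_mod_cast (W.reductionPointCount_pos p).ne'
  have hc0 : (W.tamagawaProduct : ℚ_[p]) ≠ 0 := by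
    exact_mod_cast (W.tamagawaProduct_pos_holds : 0 < W.tamagawaProduct).ne'
  have hA : (1 - (unitRoot W p : ℚ_[p])⁻¹) ^ 2 * (W.tamagawaProduct : ℚ_[p]) ≠ 0 :=
    mul_ne_zero hε0 hc0
  -- the leading-term shape from Perrin-Riou–Schneider (odd `p`)
  have hLT : fE.order = (r : ℕ) →
      Finite (AddCommGroup.primaryComponent W.sha p) ∧ padicRegulator Dh ≠ 0 ∧
        ∃ u : ℤ_[p]ˣ, ((PowerSeries.coeff r fE : ℤ_[p]) : ℚ_[p]) *
            (padicLog p (cyclotomicGenerator p) ^ r * (W.torsionOrder : ℚ_[p]) ^ 2) =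
          ((u : ℤ_[p]) : ℚ_[p]) *
            ((1 - (unitRoot W p : ℚ_[p])⁻¹) ^ 2 * (W.tamagawaProduct : ℚ_[p]) * padicRegulator Dh *
              (Nat.card (AddCommGroup.primaryComponent W.sha p) : ℚ_[p])) := by
    intro hordfE
    obtain ⟨hSch, hfin⟩ := h2.mp hordfE
    obtain ⟨u, hu⟩ := hLC hSch hfin
    refine ⟨hfin, hSch, u, ?_⟩
    rw [← mul_assoc, hu]
    ring
  obtain ⟨hfin, hR, -, hle⟩ := padicValNat_card_shaPrimary_le_of_leadingTerm_shape W p fE g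
    (hchar' ▸ hgmem) L (1 : ℚ_[p]) one_ne_zero 0 r hι hordL _ _ (padicRegulator Dh) hA hXk hLT
  refine ⟨hfin, hR, ?_⟩
  rw [one_mul, Nat.add_zero] at hle
  exact hle

/-! ### The certificate -/

/-- **Odd good ordinary `p`, `ρ_{E,p^∞}` surjective: Kato's Thm. 17.4 (3) + Perrin-Riou–Schneider +
the per-curve `p`-adic certificate give `Ш(E/ℚ)[p] = 0`, THROUGH the engine.** Hypotheses as in
`padicBSD_inequality_of_kato_of_surjective_pow`, plus the computed valuation equality
`ord_p([T^r]L_p(f, α) · log_p(γ_cyc)^r · #E(ℚ)_tors²) = ord_p((1 - α⁻¹)² · ∏ c_ℓ · Reg_p)` (`hcert`,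
"the `p`-adic analytic order of `Ш` is a `p`-adic unit"). Conclusion: every `p`-torsion class of
`Ш(E/ℚ)` is `0`. Instance of `noPTorsion_of_leadingTerm_certificate` with `c = 1`, `e = 0`; the
reducible twin is `noPTorsion_of_wuthrich16_of_leadingTerm_certificate`.
[cite: Kato2004Asterisque, Thm. 17.4 (3) (p. 273)] [cite: BalakrishnanMullerStein2015, Thm. 1.7]
[cite: SteinWuthrich2013, §§3–4] [cite: Miller2011LMS, Prop. 7.6] -/
theorem noPTorsion_of_kato_of_leadingTerm_certificate
    (hS : Schneider1985_order_charGenerator_odd)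
    (W : WeierstrassCurve ℚ) [W.IsElliptic] [W.IsGloballyMinimal] (p : ℕ) [Fact p.Prime]
    {N : ℕ} [NeZero N] (f : CuspForm (Gamma0 N) 2)
    (hK : ∀ (κ : ZpExtension ℚ p) (γ : Field.absoluteGaloisGroup ℚ),
      kato_divisibility W p (κ := κ) (γ := γ) (f := f))
    (hp : p ≠ 2) (hgood : W.HasGoodReductionAtPrime p) (hordp : ¬ (p : ℤ) ∣ W.frobeniusTrace p)
    (hsurj : ∀ n : ℕ, W.HasSurjectiveModNGaloisRep (p ^ n : ℕ)) (hf : IsNewformOf W f)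
    (Dh : PAdicHeightData W p) (hDh : Dh.IsCanonical)
    (hord : (padicLFunction f (unitRoot W p : ℚ_[p])).order = W.mordellWeilRank)
    (hcert : (PowerSeries.coeff W.mordellWeilRank (padicLFunction f (unitRoot W p : ℚ_[p])) *
          (padicLog p (cyclotomicGenerator p) ^ W.mordellWeilRank *
            (W.torsionOrder : ℚ_[p]) ^ 2)).valuation =
        ((1 - (unitRoot W p : ℚ_[p])⁻¹) ^ 2 * (W.tamagawaProduct : ℚ_[p]) *
          padicRegulator Dh).valuation) :
    ∀ x : W.sha, (p : ℤ) • x = 0 → x = 0 := by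
  have hordin : IsOrdinaryAt W p := ⟨hgood, hordp⟩
  set r := W.mordellWeilRank with hr_def
  set L := padicLFunction f (unitRoot W p : ℚ_[p]) with hL_def
  -- the cyclotomic setting, the Iwasawa module, Kato's Thm. 17.4 (3), a generator of `char_Λ X`
  obtain ⟨κ, hκ, γ, hγ, hγ'⟩ := exists_isCyclotomic_isTopGenerator_isCyclotomicVariable_holds p
  obtain ⟨D⟩ := W.nonempty_selmerDualData_holds κ γ hγ
  haveI : Module.Finite (IwasawaAlgebra p) D.X := D.module_finite_holds hγ
  obtain ⟨hX, -, h3⟩ := hK κ γ hp hordin hκ hγ hγ' hf D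
  obtain ⟨g, hgmem, hιg⟩ := h3 hsurj
  haveI : (Module.charIdeal (IwasawaAlgebra p) D.X).IsPrincipal := charIdeal_isPrincipal_holds p D.X
  obtain ⟨fE, hchar⟩ := Submodule.IsPrincipal.principal (Module.charIdeal (IwasawaAlgebra p) D.X)
  have hchar' : D.charIdeal = Ideal.span {fE} := hchar
  obtain ⟨h1, h2, hLC⟩ := hS W p hp hgood hordp κ γ hκ hγ hγ' D hX fE hchar' Dh hDh
  -- the engine's inputs (`c = 1`, `e = 0`)
  have hι : PowerSeries.C (1 : ℚ_[p]) * L = PowerSeries.X ^ 0 * iwasawaToPowerSeries p g := by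
    rw [map_one, one_mul, pow_zero, one_mul, hιg]
  have hordL : L.order = (r + 0 : ℕ) := by rw [Nat.add_zero]; exact hord
  have hXk : (PowerSeries.X : IwasawaAlgebra p) ^ r ∣ fE :=
    PowerSeries.X_pow_dvd_iff.mpr fun m hm =>
      PowerSeries.coeff_of_lt_order m (lt_of_lt_of_le (by exact_mod_cast hm) h1)
  -- `A = (1 - α⁻¹)² · ∏ c_ℓ ≠ 0`
  obtain ⟨u₂, hu₂⟩ := exists_unit_one_sub_unitRoot_inv p W hordin
  have hε0 : (1 - (unitRoot W p : ℚ_[p])⁻¹) ^ 2 ≠ 0 := by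
    rw [hu₂]
    refine pow_ne_zero 2 (mul_ne_zero (coe_units_ne_zero p u₂) ?_)
    exact_mod_cast (W.reductionPointCount_pos p).ne'
  have hc0 : (W.tamagawaProduct : ℚ_[p]) ≠ 0 := by
    exact_mod_cast (W.tamagawaProduct_pos_holds : 0 < W.tamagawaProduct).ne'
  have hA : (1 - (unitRoot W p : ℚ_[p])⁻¹) ^ 2 * (W.tamagawaProduct : ℚ_[p]) ≠ 0 :=
    mul_ne_zero hε0 hc0
  -- the leading-term shape from Perrin-Riou–Schneider (odd `p`)
  have hLT : fE.order = (r : ℕ) →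
      Finite (AddCommGroup.primaryComponent W.sha p) ∧ padicRegulator Dh ≠ 0 ∧
        ∃ u : ℤ_[p]ˣ, ((PowerSeries.coeff r fE : ℤ_[p]) : ℚ_[p]) *
            (padicLog p (cyclotomicGenerator p) ^ r * (W.torsionOrder : ℚ_[p]) ^ 2) =
          ((u : ℤ_[p]) : ℚ_[p]) *
            ((1 - (unitRoot W p : ℚ_[p])⁻¹) ^ 2 * (W.tamagawaProduct : ℚ_[p]) * padicRegulator Dh *
              (Nat.card (AddCommGroup.primaryComponent W.sha p) : ℚ_[p])) := by
    intro hordfE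
    obtain ⟨hSch, hfin⟩ := h2.mp hordfE
    obtain ⟨u, hu⟩ := hLC hSch hfin
    refine ⟨hfin, hSch, u, ?_⟩
    rw [← mul_assoc, hu]
    ring
  have hcert' : ((1 : ℚ_[p]) * PowerSeries.coeff (r + 0) L *
        (padicLog p (cyclotomicGenerator p) ^ r * (W.torsionOrder : ℚ_[p]) ^ 2)).valuation =
      ((1 - (unitRoot W p : ℚ_[p])⁻¹) ^ 2 * (W.tamagawaProduct : ℚ_[p]) *
        padicRegulator Dh).valuation := by
    rw [one_mul, Nat.add_zero]; exact hcert
  exact noPTorsion_of_leadingTerm_certificate W p fE g (hchar' ▸ hgmem) L (1 : ℚ_[p]) one_ne_zero 0 r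
    hι hordL _ _ (padicRegulator Dh) hA hXk hLT hcert'

/-- Multiplying by a `p`-adic unit does not change the valuation (with Mathlib's junk value
`ord_p 0 = 0` the identity holds even at `0`). [folklore] -/
theorem valuation_mul_eq_of_valuation_eq_zero (p : ℕ) [Fact p.Prime] {c : ℚ_[p]} (hc : c ≠ 0)
    (hcv : c.valuation = 0) (x : ℚ_[p]) : (c * x).valuation = x.valuation := by
  by_cases hx : x = 0
  · rw [hx, mul_zero]
  · rw [Padic.valuation_mul hc hx, hcv, zero_add]

/-- **The same certificate with the `E`-normalised leading coefficient.** Engines (PARI `ellpadicL`,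
the cell's modular-symbol engine) compute `E`-normalised symbols `[r]⁺_E = ϖ · [r]⁺_f` where
`ϖ · Ω_E = Ω⁺_f` (`hϖ`, documentation of the normalisation only), i.e. the coefficient
`ϖ · [T^r]L_p(f, α)`; when `ϖ` is a `p`-adic unit (`hϖv` — at an odd good prime with `E[p]`
irreducible: no `p`-isogeny in the class and `p ∤` Manin constant for `p ∤ 2N`; a per-curve CHECKED
hypothesis here, not an assertion) the valuation equality for `ϖ · [T^r]L_p` (`hcert`) is the one of
`noPTorsion_of_kato_of_leadingTerm_certificate`. [cite: SteinWuthrich2013, §§3–4 and §8]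
[cite: Kato2004Asterisque, Thm. 17.4 (3) (p. 273)] -/
theorem noPTorsion_of_kato_of_leadingTerm_certificate_of_periodUnit
    (hS : Schneider1985_order_charGenerator_odd)
    (W : WeierstrassCurve ℚ) [W.IsElliptic] [W.IsGloballyMinimal] (p : ℕ) [Fact p.Prime]
    {N : ℕ} [NeZero N] (f : CuspForm (Gamma0 N) 2)
    (hK : ∀ (κ : ZpExtension ℚ p) (γ : Field.absoluteGaloisGroup ℚ),
      kato_divisibility W p (κ := κ) (γ := γ) (f := f))
    (hp : p ≠ 2) (hgood : W.HasGoodReductionAtPrime p) (hordp : ¬ (p : ℤ) ∣ W.frobeniusTrace p)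
    (hsurj : ∀ n : ℕ, W.HasSurjectiveModNGaloisRep (p ^ n : ℕ)) (hf : IsNewformOf W f)
    (ϖ : ℚ) (_hϖ : (ϖ : ℝ) * W.realPeriodRat = plusPeriod f) (hϖv : ((ϖ : ℚ) : ℚ_[p]).valuation = 0)
    (hϖ0 : ϖ ≠ 0)
    (Dh : PAdicHeightData W p) (hDh : Dh.IsCanonical)
    (hord : (padicLFunction f (unitRoot W p : ℚ_[p])).order = W.mordellWeilRank)
    (hcert : (((ϖ : ℚ) : ℚ_[p]) *
          PowerSeries.coeff W.mordellWeilRank (padicLFunction f (unitRoot W p : ℚ_[p])) *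
          (padicLog p (cyclotomicGenerator p) ^ W.mordellWeilRank *
            (W.torsionOrder : ℚ_[p]) ^ 2)).valuation =
        ((1 - (unitRoot W p : ℚ_[p])⁻¹) ^ 2 * (W.tamagawaProduct : ℚ_[p]) *
          padicRegulator Dh).valuation) :
    ∀ x : W.sha, (p : ℤ) • x = 0 → x = 0 := by
  have hϖQ : ((ϖ : ℚ) : ℚ_[p]) ≠ 0 := by exact_mod_cast hϖ0
  refine noPTorsion_of_kato_of_leadingTerm_certificate hS W p f hK hp hgood hordp hsurj hf Dh hDh
    hord ?_
  rw [← hcert, mul_assoc, valuation_mul_eq_of_valuation_eq_zero p hϖQ hϖv]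

/-! ### `BSD(E,p)` at analytic rank `≤ 1` -/

/-- **`BSD(E,p)` from the per-curve `p`-adic certificate at an odd good ordinary prime with
`ρ_{E,p^∞}` surjective, analytic rank `≤ 1`, `p ∤ #Ш_an`** (composition with
`bsdp_of_shaAn_unit_of_noPTorsion`; Gross–Zagier–Kolyvagin `hGZK` converts the computed order of
vanishing `ord_{T=0} L_p = r_an` (`hord`) into the rank). ALL class-level inputs are PUBLISHED named
facts of the tree (`hK` Kato 2004 Thm. 17.4, `hS` BMS 2016 Thm. 1.7 / Schneider 1985, `hGZK`); the
computed data are `hord`, `hcert` and the lane's exact `#Ш_an` (`hs`, `hv`). Per curve; NOT a class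
theorem. [cite: Kato2004Asterisque, Thm. 17.4 (3) (p. 273)] [cite: BalakrishnanMullerStein2015, Thm. 1.7]
[cite: Miller2011LMS, Def. 1.1 and Prop. 7.6] -/
theorem bsdp_of_kato_of_leadingTerm_certificate
    (hS : Schneider1985_order_charGenerator_odd)
    (hGZK : rank_eq_analyticRank_of_analyticRank_le_one)
    (W : WeierstrassCurve ℚ) [W.IsElliptic] [W.IsGloballyMinimal] (p : ℕ) [Fact p.Prime]
    {N : ℕ} [NeZero N] (f : CuspForm (Gamma0 N) 2)
    (hK : ∀ (κ : ZpExtension ℚ p) (γ : Field.absoluteGaloisGroup ℚ),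
      kato_divisibility W p (κ := κ) (γ := γ) (f := f))
    (hp : p ≠ 2) (hgood : W.HasGoodReductionAtPrime p) (hordp : ¬ (p : ℤ) ∣ W.frobeniusTrace p)
    (hsurj : ∀ n : ℕ, W.HasSurjectiveModNGaloisRep (p ^ n : ℕ)) (hf : IsNewformOf W f)
    (Dh : PAdicHeightData W p) (hDh : Dh.IsCanonical) (hr : W.analyticRank ≤ 1)
    (hord : (padicLFunction f (unitRoot W p : ℚ_[p])).order = W.analyticRank)
    (hcert : (PowerSeries.coeff W.analyticRank (padicLFunction f (unitRoot W p : ℚ_[p])) *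
          (padicLog p (cyclotomicGenerator p) ^ W.analyticRank *
            (W.torsionOrder : ℚ_[p]) ^ 2)).valuation =
        ((1 - (unitRoot W p : ℚ_[p])⁻¹) ^ 2 * (W.tamagawaProduct : ℚ_[p]) *
          padicRegulator Dh).valuation)
    {s : ℚ} (hs : shaAn W = (s : ℂ)) (hv : padicValRat p s = 0) : BSDp W p := by
  have hrk : W.mordellWeilRank = W.analyticRank := (hGZK W hr).1
  refine bsdp_of_shaAn_unit_of_noPTorsion W p hGZK hr hs hv ?_
  refine noPTorsion_of_kato_of_leadingTerm_certificate hS W p f hK hp hgood hordp hsurj hf Dh hDh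
    ?_ ?_
  · rw [hrk]; exact hord
  · rw [hrk]; exact hcert

/-- **The census form: mod-`p` surjectivity at an odd good ordinary prime suffices.** At `p ≥ 5`,
`ρ̄_{E,p}` surjective gives `ρ̄_{E,p^n}` surjective for every `n` (Serre, *Abelian `ℓ`-adic
representations* IV §3.4 — tree THEOREM `serre_hasSurjectiveModNGaloisRep_pow_holds`); at `p = 3`
this fails in general (Elkies) but holds at a prime `3` of good or multiplicative reduction
(Wuthrich 2014 Lemma 20, named fact `hW20`), which is the case here (`hgood`). Hence `BSD(E,p)`
from the `p`-adic certificate at EVERY odd good ordinary `p` with `Surj W p`, analytic rank `≤ 1`,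
`p ∤ #Ш_an`. Per curve; NOT a class theorem. [cite: Wuthrich2014, Lemma 20 (p. 400)]
[cite: SerreAbelianLadic1968, Ch. IV §3.4] [cite: Kato2004Asterisque, Thm. 17.4 (3) (p. 273)] -/
theorem bsdp_of_kato_of_surj_of_leadingTerm_certificate
    (hS : Schneider1985_order_charGenerator_odd)
    (hGZK : rank_eq_analyticRank_of_analyticRank_le_one)
    (hW20 : lemma20_surjective_threeAdic_of_semistable)
    (W : WeierstrassCurve ℚ) [W.IsElliptic] [W.IsGloballyMinimal] (p : ℕ) [Fact p.Prime]
    {N : ℕ} [NeZero N] (f : CuspForm (Gamma0 N) 2)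
    (hK : ∀ (κ : ZpExtension ℚ p) (γ : Field.absoluteGaloisGroup ℚ),
      kato_divisibility W p (κ := κ) (γ := γ) (f := f))
    (hp : p ≠ 2) (hgood : W.HasGoodReductionAtPrime p) (hordp : ¬ (p : ℤ) ∣ W.frobeniusTrace p)
    (hsurj : Surj W p) (hf : IsNewformOf W f)
    (Dh : PAdicHeightData W p) (hDh : Dh.IsCanonical) (hr : W.analyticRank ≤ 1)
    (hord : (padicLFunction f (unitRoot W p : ℚ_[p])).order = W.analyticRank)
    (hcert : (PowerSeries.coeff W.analyticRank (padicLFunction f (unitRoot W p : ℚ_[p])) *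
          (padicLog p (cyclotomicGenerator p) ^ W.analyticRank *
            (W.torsionOrder : ℚ_[p]) ^ 2)).valuation =
        ((1 - (unitRoot W p : ℚ_[p])⁻¹) ^ 2 * (W.tamagawaProduct : ℚ_[p]) *
          padicRegulator Dh).valuation)
    {s : ℚ} (hs : shaAn W = (s : ℂ)) (hv : padicValRat p s = 0) : BSDp W p := by
  have hpP : p.Prime := Fact.out
  have hsurjpow : ∀ n : ℕ, W.HasSurjectiveModNGaloisRep (p ^ n : ℕ) := by
    by_cases h5 : 5 ≤ p
    · exact serre_hasSurjectiveModNGaloisRep_pow_holds W p h5 hsurj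
    · have hp3 : p = 3 := by
        have h2le := hpP.two_le
        interval_cases p
        · exact absurd rfl hp
        · rfl
        · exact absurd hpP (by decide)
      subst hp3
      exact hW20 W (Or.inl hgood) hsurj
  exact bsdp_of_kato_of_leadingTerm_certificate hS hGZK W p f hK hp hgood hordp hsurjpow hf Dh hDh hr
    hord hcert hs hv

/-! ### Class X10 instance (canonical shape, `p = 3`) -/

/-- **X10 ∩ surj(3), per curve, WITHOUT Yan–Zhu: `ClassX10 W 3 → Surj W 3 → (3-adic certificate)
→ 3 ∤ #Ш_an → BSDp W 3`.** Named facts, all PUBLISHED and all printed at `p = 3`: Kato 2004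
Thm. 17.4 (`hK`, integral clause under `3`-adic surjectivity), Perrin-Riou–Schneider / BMS 2016
Thm. 1.7 at `p > 2` (`hS`), Gross–Zagier–Kolyvagin (`hGZK`), Wuthrich 2014 Lemma 20 (`hW20`: the
class's `3` is good, so `surj(3)` gives `3`-adic surjectivity). Computed per curve: `ord_{T=0} L₃ =
r_an` (`hord`), the valuation equality (`hcert`) for THE canonical `3`-adic height (`Dh`, `hDh`;
exists uniquely, `existsUnique_isCanonical_of_odd`), and the lane's exact `#Ш_an` with
`3 ∤ #Ш_an` (`hs`, `hv`). The third per-curve route for X10a′ ∧ r = 1 (after L11 and the explicit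
`3`-descent), disjoint from both in inputs and computation, and blind to Tamagawa numbers divisible
by `3`; the CLASS statement stays Yan–Zhu 2026 Thm. 4.15 with flag `YZ26@3-BF-ERL-Ohta`
(`bsdp_of_classX10_of_surj`). Per curve; NOT a class theorem; no label changed.
[cite: Kato2004Asterisque, Thm. 17.4 (3) (p. 273)] [cite: BalakrishnanMullerStein2015, Thm. 1.7]
[cite: Wuthrich2014, Lemma 20 (p. 400)] [cite: SteinWuthrich2013, §§3–4] -/
theorem X10.bsdp_three_of_kato_of_leadingTerm_certificate
    (hS : Schneider1985_order_charGenerator_odd)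
    (hGZK : rank_eq_analyticRank_of_analyticRank_le_one)
    (hW20 : lemma20_surjective_threeAdic_of_semistable)
    (W : WeierstrassCurve ℚ) [W.IsElliptic] [W.IsGloballyMinimal]
    {N : ℕ} [NeZero N] (f : CuspForm (Gamma0 N) 2)
    (hK : ∀ (κ : ZpExtension ℚ 3) (γ : Field.absoluteGaloisGroup ℚ),
      kato_divisibility W 3 (κ := κ) (γ := γ) (f := f))
    (hX : ClassX10 W 3) (hsurj : Surj W 3) (hf : IsNewformOf W f)
    (Dh : PAdicHeightData W 3) (hDh : Dh.IsCanonical)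
    (hord : (padicLFunction f (unitRoot W 3 : ℚ_[3])).order = W.analyticRank)
    (hcert : (PowerSeries.coeff W.analyticRank (padicLFunction f (unitRoot W 3 : ℚ_[3])) *
          (padicLog 3 (cyclotomicGenerator 3) ^ W.analyticRank *
            (W.torsionOrder : ℚ_[3]) ^ 2)).valuation =
        ((1 - (unitRoot W 3 : ℚ_[3])⁻¹) ^ 2 * (W.tamagawaProduct : ℚ_[3]) *
          padicRegulator Dh).valuation)
    {s : ℚ} (hs : shaAn W = (s : ℂ)) (hv : padicValRat 3 s = 0) : BSDp W 3 :=
  bsdp_of_kato_of_surj_of_leadingTerm_certificate hS hGZK hW20 W 3 f hK (by decide) hX.2.1.1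
    hX.2.1.2 hsurj hf Dh hDh hX.analyticRank_le_one hord hcert hs hv

end Literature.NumberTheory.EllipticCurves.Rank1Residual.Typed

end
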